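import Summits.QuantumFields.GaugeBoot.Rows.KZL2rpD4BlkDefs
import Summits.QuantumFields.GaugeBoot.Rows.KZL2rpD4Lines
import Summits.QuantumFields.GaugeBoot.Rows.SymIrrH10
import Summits.QuantumFields.GaugeBoot.Rows.SymIrrH11
import Summits.QuantumFields.GaugeBoot.Rows.SymIrrH12
import Summits.QuantumFields.GaugeBoot.Rows.SymIrrH13
import Summits.QuantumFields.GaugeBoot.Rows.SymIrrH14
import Summits.QuantumFields.GaugeBoot.Rows.SymIrrH3
import Summits.QuantumFields.GaugeBoot.Rows.SymIrrH4
import Summits.QuantumFields.GaugeBoot.Rows.SymIrrH8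
import HarnessLib

/-!
# Gauge-boot: kernel check of the orbit tables, part 2/5 (blocks 4–16)

Cell `pub-gaugeboot` (HOME `run/shared/lean/pub/pub-gaugeboot/`), seat lean1 (SYMMETRY-FACTORISED torus layer for the kz-L2-rp-4D family =
rows C91–C106 / C123–C127; label set, lines, irrep data, pair/row class certification, orbit tables, reduction identity, assembly).

HONEST FRAMING (page 1 of every file of this cell): certified bounds on lattice expectations at STATED coupling,
gauge group, dimension and torus size; NOT a mass gap, NOT a continuum limit, NOT a string tension, NOT large `N`.
The venture is explicitly NOT Yang–Mills-summit-bearing (barriers `FixedCouplingUltralocality`,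
`PerturbativeInvisibility`).

For each listed block `k`: `∀ j t, t·(row line of column j) = orbit line (k, j, t)` where `t` runs over the support codes of the block's
irrep (`SymIrr.tc…`) — `decide +kernel` over nested shallow ranges (one `gactT` evaluation per entry), then the `Fin` form `orb_ok_k`.
-/

noncomputable section

open Literature.MathematicalPhysics.QuantumFieldTheory

namespace Summit.QuantumFields.GaugeBoot

namespace KZL2rpD4

set_option maxHeartbeats 0 in
/-- Orbit table of block 4 (`H/irrep13(d3,c+)`, 14 columns × 768 support codes; kernel, nested ranges). -/
theorem orb_okN_4 : ∀ j : Fin 14, ∀ x : Fin 24, ∀ z : Fin 32, 0 + 32 * x.val + z.val < 768 → SymB4.gactT (SymIrr.tcH13 (0 + 32 * x.val + z.val)) (Sn (rowLineH (hRow 4 j.val).val)) = Sn (orbH 4 j.val (0 + 32 * x.val + z.val)).val := by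
  decide +kernel

/-- Orbit table of block 4, `Fin` form. -/
theorem orb_ok_4 (j : Fin 14) (t : Fin 768) : SymB4.gactT (SymIrr.tcH13 t.val) (Sn (rowLineH (hRow 4 j.val).val)) = Sn (orbH 4 j.val t.val).val :=
  SymB4.nested_elim (P := fun t => SymB4.gactT (SymIrr.tcH13 t) (Sn (rowLineH (hRow 4 j.val).val)) = Sn (orbH 4 j.val t).val) (lo := 0) (hi := 768) (A := 24) (B := 32) (by norm_num) (orb_okN_4 j) t.val (Nat.zero_le _) t.isLt

set_option maxHeartbeats 0 in
/-- Orbit table of block 5 (`H/irrep20(d4,c+)`, 20 columns × 192 support codes; kernel, nested ranges). -/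
theorem orb_okN_5 : ∀ j : Fin 20, ∀ x : Fin 6, ∀ z : Fin 32, 0 + 32 * x.val + z.val < 192 → SymB4.gactT (SymIrr.tcH20 (0 + 32 * x.val + z.val)) (Sn (rowLineH (hRow 5 j.val).val)) = Sn (orbH 5 j.val (0 + 32 * x.val + z.val)).val := by
  decide +kernel

/-- Orbit table of block 5, `Fin` form. -/
theorem orb_ok_5 (j : Fin 20) (t : Fin 192) : SymB4.gactT (SymIrr.tcH20 t.val) (Sn (rowLineH (hRow 5 j.val).val)) = Sn (orbH 5 j.val t.val).val :=
  SymB4.nested_elim (P := fun t => SymB4.gactT (SymIrr.tcH20 t) (Sn (rowLineH (hRow 5 j.val).val)) = Sn (orbH 5 j.val t).val) (lo := 0) (hi := 192) (A := 6) (B := 32) (by norm_num) (orb_okN_5 j) t.val (Nat.zero_le _) t.isLt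

set_option maxHeartbeats 0 in
/-- Orbit table of block 6 (`H/irrep21(d4,c+)`, 10 columns × 192 support codes; kernel, nested ranges). -/
theorem orb_okN_6 : ∀ j : Fin 10, ∀ x : Fin 6, ∀ z : Fin 32, 0 + 32 * x.val + z.val < 192 → SymB4.gactT (SymIrr.tcH21 (0 + 32 * x.val + z.val)) (Sn (rowLineH (hRow 6 j.val).val)) = Sn (orbH 6 j.val (0 + 32 * x.val + z.val)).val := by
  decide +kernel

/-- Orbit table of block 6, `Fin` form. -/
theorem orb_ok_6 (j : Fin 10) (t : Fin 192) : SymB4.gactT (SymIrr.tcH21 t.val) (Sn (rowLineH (hRow 6 j.val).val)) = Sn (orbH 6 j.val t.val).val :=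
  SymB4.nested_elim (P := fun t => SymB4.gactT (SymIrr.tcH21 t) (Sn (rowLineH (hRow 6 j.val).val)) = Sn (orbH 6 j.val t).val) (lo := 0) (hi := 192) (A := 6) (B := 32) (by norm_num) (orb_okN_6 j) t.val (Nat.zero_le _) t.isLt

set_option maxHeartbeats 0 in
/-- Orbit table of block 7 (`H/irrep22(d4,c+)`, 4 columns × 192 support codes; kernel, nested ranges). -/
theorem orb_okN_7 : ∀ j : Fin 4, ∀ x : Fin 6, ∀ z : Fin 32, 0 + 32 * x.val + z.val < 192 → SymB4.gactT (SymIrr.tcH22 (0 + 32 * x.val + z.val)) (Sn (rowLineH (hRow 7 j.val).val)) = Sn (orbH 7 j.val (0 + 32 * x.val + z.val)).val := by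
  decide +kernel

/-- Orbit table of block 7, `Fin` form. -/
theorem orb_ok_7 (j : Fin 4) (t : Fin 192) : SymB4.gactT (SymIrr.tcH22 t.val) (Sn (rowLineH (hRow 7 j.val).val)) = Sn (orbH 7 j.val t.val).val :=
  SymB4.nested_elim (P := fun t => SymB4.gactT (SymIrr.tcH22 t) (Sn (rowLineH (hRow 7 j.val).val)) = Sn (orbH 7 j.val t).val) (lo := 0) (hi := 192) (A := 6) (B := 32) (by norm_num) (orb_okN_7 j) t.val (Nat.zero_le _) t.isLt

set_option maxHeartbeats 0 in
/-- Orbit table of block 8 (`H/irrep23(d4,c+)`, 3 columns × 192 support codes; kernel, nested ranges). -/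
theorem orb_okN_8 : ∀ j : Fin 3, ∀ x : Fin 6, ∀ z : Fin 32, 0 + 32 * x.val + z.val < 192 → SymB4.gactT (SymIrr.tcH23 (0 + 32 * x.val + z.val)) (Sn (rowLineH (hRow 8 j.val).val)) = Sn (orbH 8 j.val (0 + 32 * x.val + z.val)).val := by
  decide +kernel

/-- Orbit table of block 8, `Fin` form. -/
theorem orb_ok_8 (j : Fin 3) (t : Fin 192) : SymB4.gactT (SymIrr.tcH23 t.val) (Sn (rowLineH (hRow 8 j.val).val)) = Sn (orbH 8 j.val t.val).val :=
  SymB4.nested_elim (P := fun t => SymB4.gactT (SymIrr.tcH23 t) (Sn (rowLineH (hRow 8 j.val).val)) = Sn (orbH 8 j.val t).val) (lo := 0) (hi := 192) (A := 6) (B := 32) (by norm_num) (orb_okN_8 j) t.val (Nat.zero_le _) t.isLt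

set_option maxHeartbeats 0 in
/-- Orbit table of block 9 (`H/irrep28(d6,c+)`, 16 columns × 128 support codes; kernel, nested ranges). -/
theorem orb_okN_9 : ∀ j : Fin 16, ∀ x : Fin 4, ∀ z : Fin 32, 0 + 32 * x.val + z.val < 128 → SymB4.gactT (SymIrr.tcH28 (0 + 32 * x.val + z.val)) (Sn (rowLineH (hRow 9 j.val).val)) = Sn (orbH 9 j.val (0 + 32 * x.val + z.val)).val := by
  decide +kernel

/-- Orbit table of block 9, `Fin` form. -/
theorem orb_ok_9 (j : Fin 16) (t : Fin 128) : SymB4.gactT (SymIrr.tcH28 t.val) (Sn (rowLineH (hRow 9 j.val).val)) = Sn (orbH 9 j.val t.val).val :=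
  SymB4.nested_elim (P := fun t => SymB4.gactT (SymIrr.tcH28 t) (Sn (rowLineH (hRow 9 j.val).val)) = Sn (orbH 9 j.val t).val) (lo := 0) (hi := 128) (A := 4) (B := 32) (by norm_num) (orb_okN_9 j) t.val (Nat.zero_le _) t.isLt

set_option maxHeartbeats 0 in
/-- Orbit table of block 10 (`H/irrep29(d6,c+)`, 13 columns × 128 support codes; kernel, nested ranges). -/
theorem orb_okN_10 : ∀ j : Fin 13, ∀ x : Fin 4, ∀ z : Fin 32, 0 + 32 * x.val + z.val < 128 → SymB4.gactT (SymIrr.tcH29 (0 + 32 * x.val + z.val)) (Sn (rowLineH (hRow 10 j.val).val)) = Sn (orbH 10 j.val (0 + 32 * x.val + z.val)).val := by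
  decide +kernel

/-- Orbit table of block 10, `Fin` form. -/
theorem orb_ok_10 (j : Fin 13) (t : Fin 128) : SymB4.gactT (SymIrr.tcH29 t.val) (Sn (rowLineH (hRow 10 j.val).val)) = Sn (orbH 10 j.val t.val).val :=
  SymB4.nested_elim (P := fun t => SymB4.gactT (SymIrr.tcH29 t) (Sn (rowLineH (hRow 10 j.val).val)) = Sn (orbH 10 j.val t).val) (lo := 0) (hi := 128) (A := 4) (B := 32) (by norm_num) (orb_okN_10 j) t.val (Nat.zero_le _) t.isLt

set_option maxHeartbeats 0 in
/-- Orbit table of block 11 (`H/irrep30(d6,c+)`, 11 columns × 128 support codes; kernel, nested ranges). -/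
theorem orb_okN_11 : ∀ j : Fin 11, ∀ x : Fin 4, ∀ z : Fin 32, 0 + 32 * x.val + z.val < 128 → SymB4.gactT (SymIrr.tcH30 (0 + 32 * x.val + z.val)) (Sn (rowLineH (hRow 11 j.val).val)) = Sn (orbH 11 j.val (0 + 32 * x.val + z.val)).val := by
  decide +kernel

/-- Orbit table of block 11, `Fin` form. -/
theorem orb_ok_11 (j : Fin 11) (t : Fin 128) : SymB4.gactT (SymIrr.tcH30 t.val) (Sn (rowLineH (hRow 11 j.val).val)) = Sn (orbH 11 j.val t.val).val :=
  SymB4.nested_elim (P := fun t => SymB4.gactT (SymIrr.tcH30 t) (Sn (rowLineH (hRow 11 j.val).val)) = Sn (orbH 11 j.val t).val) (lo := 0) (hi := 128) (A := 4) (B := 32) (by norm_num) (orb_okN_11 j) t.val (Nat.zero_le _) t.isLt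

set_option maxHeartbeats 0 in
/-- Orbit table of block 12 (`H/irrep31(d6,c+)`, 10 columns × 128 support codes; kernel, nested ranges). -/
theorem orb_okN_12 : ∀ j : Fin 10, ∀ x : Fin 4, ∀ z : Fin 32, 0 + 32 * x.val + z.val < 128 → SymB4.gactT (SymIrr.tcH31 (0 + 32 * x.val + z.val)) (Sn (rowLineH (hRow 12 j.val).val)) = Sn (orbH 12 j.val (0 + 32 * x.val + z.val)).val := by
  decide +kernel

/-- Orbit table of block 12, `Fin` form. -/
theorem orb_ok_12 (j : Fin 10) (t : Fin 128) : SymB4.gactT (SymIrr.tcH31 t.val) (Sn (rowLineH (hRow 12 j.val).val)) = Sn (orbH 12 j.val t.val).val :=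
  SymB4.nested_elim (P := fun t => SymB4.gactT (SymIrr.tcH31 t) (Sn (rowLineH (hRow 12 j.val).val)) = Sn (orbH 12 j.val t).val) (lo := 0) (hi := 128) (A := 4) (B := 32) (by norm_num) (orb_okN_12 j) t.val (Nat.zero_le _) t.isLt

set_option maxHeartbeats 0 in
/-- Orbit table of block 13 (`H/irrep36(d8,c+)`, 30 columns × 192 support codes; kernel, nested ranges). -/
theorem orb_okN_13 : ∀ j : Fin 30, ∀ x : Fin 6, ∀ z : Fin 32, 0 + 32 * x.val + z.val < 192 → SymB4.gactT (SymIrr.tcH36 (0 + 32 * x.val + z.val)) (Sn (rowLineH (hRow 13 j.val).val)) = Sn (orbH 13 j.val (0 + 32 * x.val + z.val)).val := by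
  decide +kernel

/-- Orbit table of block 13, `Fin` form. -/
theorem orb_ok_13 (j : Fin 30) (t : Fin 192) : SymB4.gactT (SymIrr.tcH36 t.val) (Sn (rowLineH (hRow 13 j.val).val)) = Sn (orbH 13 j.val t.val).val :=
  SymB4.nested_elim (P := fun t => SymB4.gactT (SymIrr.tcH36 t) (Sn (rowLineH (hRow 13 j.val).val)) = Sn (orbH 13 j.val t).val) (lo := 0) (hi := 192) (A := 6) (B := 32) (by norm_num) (orb_okN_13 j) t.val (Nat.zero_le _) t.isLt

set_option maxHeartbeats 0 in
/-- Orbit table of block 14 (`H/irrep37(d8,c+)`, 7 columns × 192 support codes; kernel, nested ranges). -/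
theorem orb_okN_14 : ∀ j : Fin 7, ∀ x : Fin 6, ∀ z : Fin 32, 0 + 32 * x.val + z.val < 192 → SymB4.gactT (SymIrr.tcH37 (0 + 32 * x.val + z.val)) (Sn (rowLineH (hRow 14 j.val).val)) = Sn (orbH 14 j.val (0 + 32 * x.val + z.val)).val := by
  decide +kernel

/-- Orbit table of block 14, `Fin` form. -/
theorem orb_ok_14 (j : Fin 7) (t : Fin 192) : SymB4.gactT (SymIrr.tcH37 t.val) (Sn (rowLineH (hRow 14 j.val).val)) = Sn (orbH 14 j.val t.val).val :=
  SymB4.nested_elim (P := fun t => SymB4.gactT (SymIrr.tcH37 t) (Sn (rowLineH (hRow 14 j.val).val)) = Sn (orbH 14 j.val t).val) (lo := 0) (hi := 192) (A := 6) (B := 32) (by norm_num) (orb_okN_14 j) t.val (Nat.zero_le _) t.isLt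

set_option maxHeartbeats 0 in
/-- Orbit table of block 15 (`H/irrep4(d1,c-)`, 6 columns × 768 support codes; kernel, nested ranges). -/
theorem orb_okN_15 : ∀ j : Fin 6, ∀ x : Fin 24, ∀ z : Fin 32, 0 + 32 * x.val + z.val < 768 → SymB4.gactT (SymIrr.tcH4 (0 + 32 * x.val + z.val)) (Sn (rowLineH (hRow 15 j.val).val)) = Sn (orbH 15 j.val (0 + 32 * x.val + z.val)).val := by
  decide +kernel

/-- Orbit table of block 15, `Fin` form. -/
theorem orb_ok_15 (j : Fin 6) (t : Fin 768) : SymB4.gactT (SymIrr.tcH4 t.val) (Sn (rowLineH (hRow 15 j.val).val)) = Sn (orbH 15 j.val t.val).val :=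
  SymB4.nested_elim (P := fun t => SymB4.gactT (SymIrr.tcH4 t) (Sn (rowLineH (hRow 15 j.val).val)) = Sn (orbH 15 j.val t).val) (lo := 0) (hi := 768) (A := 24) (B := 32) (by norm_num) (orb_okN_15 j) t.val (Nat.zero_le _) t.isLt

set_option maxHeartbeats 0 in
/-- Orbit table of block 16 (`H/irrep5(d1,c-)`, 4 columns × 768 support codes; kernel, nested ranges). -/
theorem orb_okN_16 : ∀ j : Fin 4, ∀ x : Fin 24, ∀ z : Fin 32, 0 + 32 * x.val + z.val < 768 → SymB4.gactT (SymIrr.tcH5 (0 + 32 * x.val + z.val)) (Sn (rowLineH (hRow 16 j.val).val)) = Sn (orbH 16 j.val (0 + 32 * x.val + z.val)).val := by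
  decide +kernel

/-- Orbit table of block 16, `Fin` form. -/
theorem orb_ok_16 (j : Fin 4) (t : Fin 768) : SymB4.gactT (SymIrr.tcH5 t.val) (Sn (rowLineH (hRow 16 j.val).val)) = Sn (orbH 16 j.val t.val).val :=
  SymB4.nested_elim (P := fun t => SymB4.gactT (SymIrr.tcH5 t) (Sn (rowLineH (hRow 16 j.val).val)) = Sn (orbH 16 j.val t).val) (lo := 0) (hi := 768) (A := 24) (B := 32) (by norm_num) (orb_okN_16 j) t.val (Nat.zero_le _) t.isLt

end KZL2rpD4

end Summit.QuantumFields.GaugeBoot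

end
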